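import Literature.Computability.Complexity.Classes
import Literature.Computability.Complexity.Nondeterministic
import Literature.Computability.Complexity.NondeterministicProofs
import Literature.Computability.Complexity.PolyHierarchy
import Literature.Computability.Complexity.NPClosureProofs
import Literature.Computability.Complexity.SigmaPAlternation
import Literature.Computability.Complexity.BrickAlgebra
import Literature.Computability.Complexity.StringEquality
import Literature.Computability.Complexity.StringSwap
import Literature.Computability.Complexity.LengthCompare
import Literature.Computability.Complexity.FinitePatching
import Literature.Computability.Complexity.BranchingFn
import Literature.Computability.Complexity.StringCopy
import Literature.Computability.Complexity.PromiseProofs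
import HarnessLib

/-!
# Input-anchored alternating presentations: the uniform class `Σ^p_{s(n)}` (`SigmaDepth s`)

Trunk toolkit (`Literature/Computability/Complexity`), companion of `SigmaPAlternation.lean`.

The tree's negamax semantics `altVal B ps x` (`SigmaPAlternation.lean`) evaluates the certificate
polynomial at the length of the ACCUMULATED position `⟨⟨x, y₁⟩, …, y_j⟩` and the pairing doubles the
accumulated component, so along a game of `d` levels the positions have length `≥ 2^d · |x|`: this is
Stockmeyer's `Σₖᵖ` for every FIXED `k` (`altLang_mem_SigmaP`), but for an UNBOUNDED number `d(n)` of
levels the matrix `B ∈ P` is clocked in an exponentially padded input and the class degenerates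
(census note decomp-pnenp T53, 2026-08-30: `{L | x ∈ L ↔ altVal B (replicate d(|x|) p) x} ⊄ P` outright
for every unbounded FP-selector `d`, by padding + the deterministic time hierarchy).

This file gives the INPUT-ANCHORED semantics in which the class of languages with a uniform
alternating presentation of depth `s(n)` is the intended `Σ^p_{s(n)}` (Chandra–Kozen–Stockmeyer 1981 §4
alternation-bounded ATMs; Fortnow 2000 §6; see also Ko, SIAM J. Comput. 18 (1989) §2):

* `altValFrom n B ps z` — `altValFrom n B [] z = [z ∈ B]`,
  `altValFrom n B (p :: ps) z = ∃ y, |y| ≤ p(n) ∧ ¬ altValFrom n B ps ⟨y, z⟩`: certificate lengths are bounded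
  by `p` of the ORIGINAL input length `n`, and the certificate (the SHORT component) is the doubled
  component of the pair, so after `j` levels the position `⟨y_j, ⟨y_{j-1}, … ⟨y₁, x⟩⟩⟩` has length
  `|x| + Σ_j (2|y_j| + 2) ≤ |x| + certBudget n ps` — polynomial in `n` for polynomially many levels.
* `altValFrom_congr` — LOCALITY / ANTI-BLOW-UP CERTIFICATE: the value depends only on the matrix `B`
  restricted to strings of length `≤ |z| + certBudget n ps` (`certBudget n ps = Σ_{p ∈ ps} (2 p(n) + 2)`).
* `SigmaDepth s` — languages `L` with ONE matrix `B ∈ P`, ONE certificate polynomial `p` and a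
  polynomial-time depth selector `f ∈ FP`, `|f x| ≤ s |x|`, such that
  `x ∈ L ↔ altValFrom |x| B (replicate |f x| p) x`. Basic API: `P ⊆ SigmaDepth s`, `NP ⊆ SigmaDepth s`
  for `s ≥ 1` (`NP_subset_sigmaDepth`), monotonicity in `s`.
* BRIDGE TO STOCKMEYER'S HIERARCHY at constant depth (`altLevelLang_mem_SigmaP`): for `B ∈ P` the
  language `{w | altValFrom (coreLen i w) B (replicate j p) w}` of positions with `i` certificates absorbed
  and `j` levels to go is in `Σⱼᵖ` (induction on `j`, all `i` at once, through the tree's closure of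
  `Σⱼᵖ` under `FP`-preimages and `∪` with `P` languages, `SigmaP_closure`; the witness language swaps
  the pair with the tree's `swapFn ∈ FP`). Consequence (`sigmaDepth_subset_P_of_bounded`): if `NP ⊆ P`
  then `SigmaDepth s ⊆ P` for every BOUNDED `s` (finite patching over the selector value) — the
  alternation dial's decided bottom.

Everything is proved; no named facts, no instances, no notation. (Module written by the decomp-pnenp cell,
lens decomp-pnenp-lens-6 g9, for definition item `defn-SigmaDepth`; landed verbatim up to one lemma rename.)

NOT in this file (owed, none needed by the route laws): (a) `SigmaDepth (fun _ => k) ⊆ SigmaP k` — needs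
closure of `SigmaP k` under binary union (the tree has union WITH a `P` language only, `SigmaP_closure`);
what is proved is its heart `altLevelLang_mem_SigmaP` and the collapse form
`sigmaDepth_subset_P_of_bounded`; (b) the converse `SigmaP k ⊆ SigmaDepth (fun _ => k)` (normal form
with a loser-on-violation matrix); (c) `SigmaDepth s ⊆ PSPACE` (Chandra–Kozen–Stockmeyer 1981 Cor. 3.6;
positions are polynomial by `altValFrom_congr`, so this is theorem-shaped).

## References

* A. K. Chandra, D. C. Kozen, L. J. Stockmeyer, *Alternation*, J. ACM 28 (1981), §3–§4 (alternation-
  bounded alternating Turing machines; `ATIME(poly) = PSPACE`, Cor. 3.6). [ChandraKozenStockmeyer1981]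
* L. J. Stockmeyer, *The polynomial-time hierarchy*, TCS 3 (1976), §3 Thm. 3.1. [Stockmeyer1976]
* L. Fortnow, *Time–space tradeoffs for satisfiability*, JCSS 60 (2000), §6 Thms 6.1–6.3 (the classes
  `Σ^p_{s(n)}` for unbounded `s`). [Fortnow2000]
* K.-I. Ko, *Relativized polynomial time hierarchies having exactly k levels*, SIAM J. Comput. 18
  (1989), §2 (no bib key: the tree's `Ko1989` is Ko's 1989 survey chapter, a different work).
* S. Arora, B. Barak, *Computational Complexity: A Modern Approach*, CUP 2009, Def. 5.3, Thm. 5.4.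
  [AroraBarakCC2009]
-/

namespace Literature.Computability.Complexity

open _root_.Computability Polynomial Brick

/-! ### The input-anchored alternating semantics -/

/-- **Input-anchored alternating (negamax) certificate semantics.** `altValFrom n B [] z = [z ∈ B]` and
`altValFrom n B (p :: ps) z = ∃ y, |y| ≤ p(n) ∧ ¬ altValFrom n B ps ⟨y, z⟩`: the existential player appends a
certificate of length at most `p(n)` — `n` is the ORIGINAL input length, fixed along the game — IN
FRONT of the position (the certificate is the doubled component of `boolPair`) and hands the negated
game to the opponent. [cite: ChandraKozenStockmeyer1981, §4; Stockmeyer1976, §3 Thm. 3.1] -/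
def altValFrom (n : ℕ) (B : Language Bool) : List (Polynomial ℕ) → List Bool → Prop
  | [], z => z ∈ B
  | p :: ps, z => ∃ y : List Bool, y.length ≤ p.eval n ∧ ¬ altValFrom n B ps (boolPair y z)

/-- `altValFrom n B [] z ↔ z ∈ B` (unfolding of the cited semantics). [cite: ChandraKozenStockmeyer1981, §4] -/
@[simp] theorem altValFrom_nil (n : ℕ) (B : Language Bool) (z : List Bool) : altValFrom n B [] z ↔ z ∈ B :=
  Iff.rfl

/-- `altValFrom n B (p :: ps) z ↔ ∃ y, |y| ≤ p(n) ∧ ¬ altValFrom n B ps ⟨y, z⟩` (unfolding of the cited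
semantics). [cite: ChandraKozenStockmeyer1981, §4] -/
theorem altValFrom_cons (n : ℕ) (B : Language Bool) (p : Polynomial ℕ) (ps : List (Polynomial ℕ))
    (z : List Bool) :
    altValFrom n B (p :: ps) z ↔ ∃ y : List Bool, y.length ≤ p.eval n ∧ ¬ altValFrom n B ps (boolPair y z) :=
  Iff.rfl

/-- **Certificate budget** of a list of certificate polynomials at parameter `n`:
`certBudget n ps = Σ_{p ∈ ps} (2 p(n) + 2)` — the total length the game can add to a position.
[cite: ChandraKozenStockmeyer1981, §4] -/
def certBudget (n : ℕ) : List (Polynomial ℕ) → ℕ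
  | [] => 0
  | p :: ps => (2 * p.eval n + 2) + certBudget n ps

/-- `certBudget n [] = 0` (unfolding). [cite: ChandraKozenStockmeyer1981, §4] -/
@[simp] theorem certBudget_nil (n : ℕ) : certBudget n [] = 0 := rfl

/-- `certBudget n (p :: ps) = 2 p(n) + 2 + certBudget n ps` (unfolding). [cite: ChandraKozenStockmeyer1981, §4] -/
@[simp] theorem certBudget_cons (n : ℕ) (p : Polynomial ℕ) (ps : List (Polynomial ℕ)) :
    certBudget n (p :: ps) = (2 * p.eval n + 2) + certBudget n ps := rfl

/-- `certBudget n (replicate d p) = d · (2 p(n) + 2)`: the position budget of a depth-`d` game.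
[cite: ChandraKozenStockmeyer1981, §4] -/
theorem certBudget_replicate (n d : ℕ) (p : Polynomial ℕ) :
    certBudget n (List.replicate d p) = d * (2 * p.eval n + 2) := by
  induction d with
  | zero => simp
  | succ d ih => rw [List.replicate_succ, certBudget_cons, ih]; ring

/-- **LOCALITY (anti-blow-up certificate).** The value `altValFrom n B ps z` depends only on the matrix
`B` restricted to strings of length at most `|z| + certBudget n ps`: every position reached from `z`
has length `|z| + Σ_j (2|y_j| + 2) ≤ |z| + certBudget n ps`. In particular for the presentation of an
input `x` of length `n` at depth `d` with polynomial `p`, the matrix is consulted only on strings of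
length `≤ n + d (2 p(n) + 2)`. [cite: ChandraKozenStockmeyer1981, §4] -/
theorem altValFrom_congr {n : ℕ} {B B' : Language Bool} :
    ∀ (ps : List (Polynomial ℕ)) (z : List Bool),
      (∀ w : List Bool, w.length ≤ z.length + certBudget n ps → (w ∈ B ↔ w ∈ B')) →
      (altValFrom n B ps z ↔ altValFrom n B' ps z)
  | [], z, h => by
    simpa [altValFrom] using h z (by simp)
  | p :: ps, z, h => by
    simp only [altValFrom_cons]
    refine exists_congr fun y => and_congr_right fun hy => not_congr ?_
    refine altValFrom_congr ps (boolPair y z) fun w hw => h w ?_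
    rw [length_boolPair] at hw
    rw [certBudget_cons]
    omega

/-- The matrix may be cut down to the strings of length `≤ |z| + certBudget n ps` without changing
the value. [cite: ChandraKozenStockmeyer1981, §4] -/
theorem altValFrom_iff_restrict (n : ℕ) (B : Language Bool) (ps : List (Polynomial ℕ)) (z : List Bool) :
    altValFrom n B ps z ↔
      altValFrom n (B ⊓ {w | w.length ≤ z.length + certBudget n ps}) ps z :=
  altValFrom_congr ps z fun _ hw =>
    ⟨fun hB => ⟨hB, hw⟩, fun h => h.1⟩

/-- Polynomials over `ℕ` are monotone under evaluation (the same folklore fact appears file-locally as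
`eval_mono_nat` in `ArthurMerlinKarpClosure.lean` / `UniformDerandomizationRSRWrap.lean`; renamed here to
keep this toolkit file import-light and its fully-qualified names unique). [folklore] -/
private theorem polyEval_mono_nat (p : Polynomial ℕ) {a b : ℕ} (h : a ≤ b) : p.eval a ≤ p.eval b := by
  induction p using Polynomial.induction_on' with
  | add p q hp hq => simpa only [eval_add] using Nat.add_le_add hp hq
  | monomial k c =>
    simp only [eval_monomial]
    exact Nat.mul_le_mul_left _ (Nat.pow_le_pow_left h k)

/-! ### The class `SigmaDepth s` -/

/-- **`SigmaDepth s`** — the uniform class `Σ^p_{s(n)}`: languages with an input-anchored alternating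
presentation of depth at most `s(n)`: one matrix `B ∈ P`, one certificate polynomial `p`, a
polynomial-time depth selector `f ∈ FP` with `|f x| ≤ s |x|`, and
`x ∈ L ↔ altValFrom |x| B (replicate |f x| p) x`. Positions have length `≤ |x| + |f x| · (2 p |x| + 2)`
(`altValFrom_congr`, `certBudget_replicate`). [cite: ChandraKozenStockmeyer1981, §4; Fortnow2000, §6] -/
def SigmaDepth (s : ℕ → ℕ) : Set (Language Bool) :=
  {L | ∃ B ∈ Classes.P, ∃ p : Polynomial ℕ, ∃ f ∈ FP,
    (∀ x : List Bool, (f x).length ≤ s x.length) ∧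
    ∀ x : List Bool, x ∈ L ↔ altValFrom x.length B (List.replicate (f x).length p) x}

/-- Membership in `SigmaDepth s` (unfolding of the class `Σ^p_{s(n)}`). [cite: Fortnow2000, §6] -/
theorem mem_sigmaDepth_iff (s : ℕ → ℕ) (L : Language Bool) :
    L ∈ SigmaDepth s ↔ ∃ B ∈ Classes.P, ∃ p : Polynomial ℕ, ∃ f ∈ FP,
      (∀ x : List Bool, (f x).length ≤ s x.length) ∧
      ∀ x : List Bool, x ∈ L ↔ altValFrom x.length B (List.replicate (f x).length p) x :=
  Iff.rfl

/-- The dial is monotone in the depth: `s ≤ t ⇒ SigmaDepth s ⊆ SigmaDepth t` (immediate from the cited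
definition). [cite: Fortnow2000, §6] -/
theorem sigmaDepth_mono {s t : ℕ → ℕ} (h : ∀ n, s n ≤ t n) : SigmaDepth s ⊆ SigmaDepth t :=
  fun _ ⟨B, hB, p, f, hf, hfs, hL⟩ => ⟨B, hB, p, f, hf, fun x => (hfs x).trans (h _), hL⟩

/-- `P ⊆ SigmaDepth s` (depth `0`: the matrix itself, selector the constant `[]`; `Σ^p_0 = P`).
[cite: Fortnow2000, §6; AroraBarakCC2009, Def. 5.3] -/
theorem P_subset_sigmaDepth (s : ℕ → ℕ) : Classes.P ⊆ SigmaDepth s :=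
  fun L hL => ⟨L, hL, 0, fun _ => [], const_mem_FP [], fun _ => Nat.zero_le _, fun _ => Iff.rfl⟩

/-- **`NP ⊆ SigmaDepth s` as soon as `s ≥ 1`**: for `L = {x | ∃ y, |y| ≤ q|x| ∧ ⟨x, y⟩ ∈ N}`, `N ∈ P`,
take the matrix `(swapFn⁻¹ N)ᶜ ∈ P`, the polynomial `q` and the constant selector of length `1`:
`altValFrom |x| (swapFn⁻¹ N)ᶜ [q] x = ∃ y, |y| ≤ q|x| ∧ ¬ ⟨y, x⟩ ∉ swapFn⁻¹ N`. [cite: AroraBarakCC2009, Def. 5.3] -/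
theorem NP_subset_sigmaDepth {s : ℕ → ℕ} (hs : ∀ n, 1 ≤ s n) :
    Nondeterministic.NP ⊆ SigmaDepth s := by
  intro L hL
  obtain ⟨N, hN, q, hq⟩ := hL
  have hB : ((swapFn ⁻¹' N)ᶜ : Language Bool) ∈ Classes.P :=
    compl_mem_P_iff.2 (preimage_mem_P hN swapFn_mem_FP)
  refine ⟨(swapFn ⁻¹' N)ᶜ, hB, q, fun _ => [true], const_mem_FP [true], fun x => hs x.length,
    fun x => ?_⟩
  rw [hq x]
  show _ ↔ altValFrom x.length (swapFn ⁻¹' N)ᶜ [q] x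
  rw [altValFrom_cons]
  refine exists_congr fun y => and_congr_right fun _ => ?_
  rw [altValFrom_nil]
  have hmem : boolPair y x ∈ ((swapFn ⁻¹' N)ᶜ : Language Bool) ↔ ¬ boolPair x y ∈ N := by
    have h1 : boolPair y x ∈ ((swapFn ⁻¹' N)ᶜ : Language Bool) ↔ ¬ swapFn (boolPair y x) ∈ N := Iff.rfl
    rw [h1, swapFn_boolPair]
  rw [hmem, not_not]

/-! ### The bridge to Stockmeyer's hierarchy at constant depth -/

/-- Length of the core of a position after peeling `i` certificates from the front:
`coreLen 0 w = |w|`, `coreLen (i+1) w = |sndPow i w|` (`= |sndF^[i+1] w|`); plumbing of the proof of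
Stockmeyer's Thm. 3.1. [folklore] -/
def altCoreLen : ℕ → List Bool → ℕ
  | 0, w => w.length
  | i + 1, w => (sndPow i w).length

/-- `altCoreLen 0 w = |w|` (unfolding; plumbing of the cited proof). [cite: Stockmeyer1976, §3 Thm. 3.1] -/
@[simp] theorem altCoreLen_zero (w : List Bool) : altCoreLen 0 w = w.length := rfl

/-- Peeling one certificate: `altCoreLen (i+1) ⟨y, w⟩ = altCoreLen i w` (plumbing of the cited proof).
[cite: Stockmeyer1976, §3 Thm. 3.1] -/
@[simp] theorem altCoreLen_succ_boolPair (i : ℕ) (y w : List Bool) :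
    altCoreLen (i + 1) (boolPair y w) = altCoreLen i w := by
  cases i with
  | zero => simp [altCoreLen]
  | succ i => simp [altCoreLen]

/-- The core is not longer than the position (plumbing of the cited proof).
[cite: Stockmeyer1976, §3 Thm. 3.1] -/
theorem altCoreLen_le (i : ℕ) (w : List Bool) : altCoreLen i w ≤ w.length := by
  cases i with
  | zero => simp
  | succ i => exact length_sndPow_le i w

/-- The core as a string function (`altCoreStr 0 = id`, `altCoreStr (i+1) = sndPow i`), of length
`altCoreLen i w`. [folklore] -/
def altCoreStr : ℕ → List Bool → List Bool
  | 0 => fun w => w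
  | i + 1 => sndPow i

/-- `|altCoreStr i w| = altCoreLen i w` (plumbing of the cited proof). [cite: Stockmeyer1976, §3 Thm. 3.1] -/
theorem length_altCoreStr (i : ℕ) (w : List Bool) : (altCoreStr i w).length = altCoreLen i w := by
  cases i <;> rfl

/-- `altCoreStr i ∈ FP` (iterated second projection; plumbing of the cited proof).
[cite: Stockmeyer1976, §3 Thm. 3.1] -/
theorem altCoreStr_mem_FP : ∀ i : ℕ, altCoreStr i ∈ FP
  | 0 => PolyTimeComputable.id _
  | i + 1 => sndPow_mem_FP i

/-- **Level languages** of a presentation `(B, p)`: positions `w` with `i` certificates absorbed (so the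
original input length is `altCoreLen i w`) and `j` levels to go. [cite: Stockmeyer1976, §3 Thm. 3.1] -/
def altLevelLang (B : Language Bool) (p : Polynomial ℕ) (j i : ℕ) : Set (List Bool) :=
  {w | altValFrom (altCoreLen i w) B (List.replicate j p) w}

/-- Membership in a level language (unfolding). [cite: Stockmeyer1976, §3 Thm. 3.1] -/
theorem mem_altLevelLang (B : Language Bool) (p : Polynomial ℕ) (j i : ℕ) (w : List Bool) :
    w ∈ altLevelLang B p j i ↔ altValFrom (altCoreLen i w) B (List.replicate j p) w :=
  Iff.rfl

/-- With no level to go the level language is the matrix (`Σ₀ᵖ` base of the cited induction).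
[cite: Stockmeyer1976, §3 Thm. 3.1] -/
theorem altLevelLang_zero (B : Language Bool) (p : Polynomial ℕ) (i : ℕ) : altLevelLang B p 0 i = B := by
  ext w
  rw [mem_altLevelLang, List.replicate_zero, altValFrom_nil]
  rfl

/-- **Bound-check language** of level `i`: pairs `⟨w, y⟩` with `|y| ≤ p (altCoreLen i w)`. [folklore] -/
def altBoundLang (p : Polynomial ℕ) (i : ℕ) : Set (List Bool) :=
  {v | (sndF v).length ≤ p.eval (altCoreStr i (fstF v)).length}

/-- Membership of a pair in the bound-check language (unfolding; plumbing of the cited proof).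
[cite: Stockmeyer1976, §3 Thm. 3.1] -/
theorem boolPair_mem_altBoundLang (p : Polynomial ℕ) (i : ℕ) (w y : List Bool) :
    boolPair w y ∈ altBoundLang p i ↔ y.length ≤ p.eval (altCoreLen i w) := by
  rw [altBoundLang, Set.mem_setOf_eq, sndF_boolPair, fstF_boolPair, length_altCoreStr]

/-- The bound-check language is the `FP`-preimage `(w ↦ ⟨altCoreStr i (fst w), snd w⟩)⁻¹ (LenLe p)`,
hence in `P`. [cite: AroraBarakCC2009, Def. 2.1, §1.3] -/
theorem altBoundLang_mem_P (p : Polynomial ℕ) (i : ℕ) : (altBoundLang p i : Language Bool) ∈ Classes.P := by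
  have hpre : ((fanoutFn (altCoreStr i ∘ fstF) sndF) ⁻¹' LenLe p : Language Bool) ∈ Classes.P :=
    preimage_mem_P (LenLe_mem_P p)
      (fanoutFn_mem_FP (comp_mem_FP (altCoreStr_mem_FP i) fstF_mem_FP) sndF_mem_FP)
  have heq : altBoundLang p i = (fanoutFn (altCoreStr i ∘ fstF) sndF) ⁻¹' LenLe p := by
    ext v
    rw [Set.mem_preimage, fanoutFn_apply, Function.comp_apply, altBoundLang, Set.mem_setOf_eq]
    exact (boolPair_mem_LenLe p (altCoreStr i (fstF v)) (sndF v)).symm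
  rw [heq]
  exact hpre

/-- **Witness language** of the bridge at `(j, i)`: pairs `⟨w, y⟩` passing the bound check of level `i`
whose swap `⟨y, w⟩` does NOT satisfy the game with `j` levels to go. [cite: Stockmeyer1976, §3 Thm. 3.1] -/
def altWitLang (B : Language Bool) (p : Polynomial ℕ) (j i : ℕ) : Set (List Bool) :=
  altBoundLang p i ∩ (swapFn ⁻¹' altLevelLang B p j (i + 1))ᶜ

/-- Membership of a pair in the witness language (unfolding; plumbing of the cited proof).
[cite: Stockmeyer1976, §3 Thm. 3.1] -/
theorem boolPair_mem_altWitLang (B : Language Bool) (p : Polynomial ℕ) (j i : ℕ) (w y : List Bool) :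
    boolPair w y ∈ altWitLang B p j i ↔
      y.length ≤ p.eval (altCoreLen i w) ∧
        ¬ altValFrom (altCoreLen i w) B (List.replicate j p) (boolPair y w) := by
  rw [altWitLang, Set.mem_inter_iff, Set.mem_compl_iff, Set.mem_preimage, boolPair_mem_altBoundLang,
    swapFn_boolPair, mem_altLevelLang, altCoreLen_succ_boolPair]

/-- The complement of the witness language: bound check fails, or the swap is in the level language
(plumbing of the cited proof). [cite: Stockmeyer1976, §3 Thm. 3.1] -/
theorem compl_altWitLang (B : Language Bool) (p : Polynomial ℕ) (j i : ℕ) :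
    (altWitLang B p j i)ᶜ = (altBoundLang p i)ᶜ ∪ swapFn ⁻¹' altLevelLang B p j (i + 1) := by
  rw [altWitLang, Set.compl_inter, compl_compl]

/-- One level of the bridge: `w` is in the level language `(j+1, i)` iff some `y` with `|y| ≤ p |w|`
puts `⟨w, y⟩` into the witness language (the inner bound `|y| ≤ p (altCoreLen i w) ≤ p |w|` is part of
the witness language). [cite: Stockmeyer1976, §3 Thm. 3.1] -/
theorem mem_altLevelLang_succ_iff (B : Language Bool) (p : Polynomial ℕ) (j i : ℕ) (w : List Bool) :
    w ∈ altLevelLang B p (j + 1) i ↔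
      ∃ y : List Bool, y.length ≤ p.eval w.length ∧ boolPair w y ∈ altWitLang B p j i := by
  rw [mem_altLevelLang, List.replicate_succ, altValFrom_cons]
  constructor
  · rintro ⟨y, hy, hnot⟩
    exact ⟨y, hy.trans (polyEval_mono_nat p (altCoreLen_le i w)),
      (boolPair_mem_altWitLang B p j i w y).2 ⟨hy, hnot⟩⟩
  · rintro ⟨y, -, hw⟩
    obtain ⟨hy, hnot⟩ := (boolPair_mem_altWitLang B p j i w y).1 hw
    exact ⟨y, hy, hnot⟩

/-- **BRIDGE: the level languages of a `P` matrix are in Stockmeyer's hierarchy** — with `j` levels to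
go the level language is in `Σⱼᵖ`, for every number `i` of absorbed certificates (induction on `j` for
all `i` at once: `Σⱼ₊₁ = ∃ᵖ·Πⱼ` with the witness language, whose complement
`(bound check)ᶜ ∪ swapFn⁻¹(level language (j, i+1))` is in `Σⱼᵖ` by closure under `∪` with `P` languages and
`FP`-preimages, `SigmaP_closure`). [cite: Stockmeyer1976, §3 Thm. 3.1; AroraBarakCC2009, Def. 5.3] -/
theorem altLevelLang_mem_SigmaP {B : Language Bool} (hB : B ∈ Classes.P) (p : Polynomial ℕ) :
    ∀ j i : ℕ, (altLevelLang B p j i : Language Bool) ∈ SigmaP j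
  | 0, i => by rw [altLevelLang_zero]; exact hB
  | j + 1, i => by
    have ih : (altLevelLang B p j (i + 1) : Language Bool) ∈ SigmaP j :=
      altLevelLang_mem_SigmaP hB p j (i + 1)
    have hsup : ((altBoundLang p i : Language Bool))ᶜ ⊔
        (swapFn ⁻¹' altLevelLang B p j (i + 1) : Language Bool) ∈ SigmaP j :=
      (SigmaP_closure j).2.2 (compl_mem_P_iff.2 (altBoundLang_mem_P p i))
        ((SigmaP_closure j).1 ih swapFn_mem_FP)
    have hEq : ((altWitLang B p j i : Language Bool))ᶜ =
        ((altBoundLang p i : Language Bool))ᶜ ⊔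
          (swapFn ⁻¹' altLevelLang B p j (i + 1) : Language Bool) :=
      compl_altWitLang B p j i
    have hWc : ((altWitLang B p j i : Language Bool))ᶜ ∈ SigmaP j := by
      rw [hEq]; exact hsup
    have hW : (altWitLang B p j i : Language Bool) ∈ PiP j := hWc
    rw [SigmaP_succ]
    exact ⟨altWitLang B p j i, hW, p, fun w => mem_altLevelLang_succ_iff B p j i w⟩

/-- The presented language at selector value `j` is the level language `(j, 0)` (unfolding).
[cite: Stockmeyer1976, §3 Thm. 3.1] -/
theorem altValFrom_iff_mem_altLevelLang (B : Language Bool) (p : Polynomial ℕ) (j : ℕ) (x : List Bool) :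
    altValFrom x.length B (List.replicate j p) x ↔ x ∈ altLevelLang B p j 0 := by
  rw [mem_altLevelLang, altCoreLen_zero]

/-! ### The decided bottom of the dial: bounded depth collapses with `NP` -/

/-- `NP ⊆ P ⇒ Σₖᵖ ⊆ P` for every `k` (Arora–Barak Thm 5.4; re-proved import-light from `co P = P`).
[cite: AroraBarakCC2009, Thm. 5.4] -/
theorem SigmaP_subset_P_of_NP_subset_P (hc : Nondeterministic.NP ⊆ Classes.P) :
    ∀ k : ℕ, SigmaP k ⊆ Classes.P
  | 0 => fun _ hL => hL
  | k + 1 => by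
    intro L hL
    have hL' : L ∈ polyExists (co (SigmaP k)) := by
      rw [← PiP_eq_co, ← SigmaP_succ]; exact hL
    have hcoP : co Classes.P = Classes.P := co_P_holds
    have hL'' : L ∈ polyExists Classes.P :=
      hcoP ▸ polyExists_mono (co_mono (SigmaP_subset_P_of_NP_subset_P hc k)) hL'
    exact hc hL''

/-- `{w | |w| = m} ∈ P` (the constant-`[0]` function finitely patched; a length test is polynomial time).
[cite: AroraBarakCC2009, §1.6 (the class P)] -/
theorem lengthEq_mem_P (m : ℕ) : ({w | w.length = m} : Language Bool) ∈ Classes.P := by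
  have hg : (fun w : List Bool => if w.length = m then [true] else [false]) ∈ FP := by
    refine mem_FP_of_eqOn_le (const_mem_FP [false]) (m + 1) fun z hz => ?_
    show (if z.length = m then [true] else [false]) = [false]
    rw [if_neg (by omega)]
  refine mem_P_of_mem_FP hg _ fun w => ⟨fun hw => ?_, fun hw => ?_⟩
  · have hw' : w.length = m := hw
    show (if w.length = m then [true] else [false]) = [true]
    rw [if_pos hw']
  · have hw' : ¬ (w.length = m) := hw
    show (if w.length = m then [true] else [false]) = [false]
    rw [if_neg hw']

/-- **DECIDED BOTTOM of the alternation dial.** If `NP ⊆ P` then every BOUNDED depth collapses: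
`s ≤ k ⇒ SigmaDepth s ⊆ P`. (`L ∈ SigmaDepth s` is the finite union over the selector value `j ≤ k` of
`f⁻¹{w | |w| = j} ∩ (level language (j, 0))`, each in `P`: `Σⱼᵖ ⊆ P` by the collapse and the bridge;
`P` is closed under `FP`-preimages, `∩`, `∪`.) [cite: AroraBarakCC2009, Thm. 5.4; Stockmeyer1976, §3] -/
theorem sigmaDepth_subset_P_of_bounded (hc : Nondeterministic.NP ⊆ Classes.P) {s : ℕ → ℕ} (k : ℕ)
    (hk : ∀ n, s n ≤ k) : SigmaDepth s ⊆ Classes.P := by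
  intro L hL
  obtain ⟨B, hB, p, f, hf, hfs, hLiff⟩ := hL
  have hU : ∀ m : ℕ,
      ({x | (f x).length < m ∧ altValFrom x.length B (List.replicate (f x).length p) x} : Language Bool)
        ∈ Classes.P := by
    intro m
    induction m with
    | zero =>
      exact mem_P_of_mem_FP (const_mem_FP [false]) _ fun w =>
        ⟨fun hw => (Nat.not_lt_zero _ hw.1).elim, fun _ => rfl⟩
    | succ m ih =>
      have hlevel : (altLevelLang B p m 0 : Language Bool) ∈ Classes.P :=
        SigmaP_subset_P_of_NP_subset_P hc m (altLevelLang_mem_SigmaP hB p m 0)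
      have hsel : (f ⁻¹' {w | w.length = m} : Language Bool) ∈ Classes.P :=
        preimage_mem_P (lengthEq_mem_P m) hf
      have heq : ({x | (f x).length < m + 1 ∧ altValFrom x.length B (List.replicate (f x).length p) x} :
            Language Bool)
          = {x | (f x).length < m ∧ altValFrom x.length B (List.replicate (f x).length p) x} ⊔
            ((f ⁻¹' {w | w.length = m}) ⊓ (altLevelLang B p m 0 : Language Bool)) := by
        ext x
        simp only [Set.sup_eq_union, Set.inf_eq_inter, Set.mem_union, Set.mem_inter_iff,
          Set.mem_setOf_eq, Set.mem_preimage, mem_altLevelLang, altCoreLen_zero]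
        constructor
        · rintro ⟨hlt, hv⟩
          rcases Nat.lt_succ_iff_lt_or_eq.1 hlt with h | h
          · exact Or.inl ⟨h, hv⟩
          · refine Or.inr ⟨h, ?_⟩
            rw [← h]
            exact hv
        · rintro (⟨h, hv⟩ | ⟨h, hv⟩)
          · exact ⟨Nat.lt_succ_of_lt h, hv⟩
          · refine ⟨by omega, ?_⟩
            rw [h]
            exact hv
      rw [heq]
      exact union_mem_P ih (inter_mem_P hsel hlevel)
  have hLeq : L = {x | (f x).length < k + 1 ∧ altValFrom x.length B (List.replicate (f x).length p) x} := by
    ext x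
    show x ∈ L ↔ ((f x).length < k + 1 ∧ altValFrom x.length B (List.replicate (f x).length p) x)
    rw [hLiff x]
    exact ⟨fun h => ⟨Nat.lt_succ_of_le ((hfs x).trans (hk _)), h⟩, fun h => h.2⟩
  rw [hLeq]
  exact hU (k + 1)

end Literature.Computability.Complexity
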